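import Mathlib
import HarnessLib
import Literature.MathematicalPhysics.QuantumLattice.TorusShellCounting

/-!
# Route `KLProgramme` — ENGINE item stmt-HubbardSuperconductivity-20437, row (C) credit path, GAP G-005 «TADPOLE-NONVANISHING»:
# A LOWER COUNT OF THE VAN HOVE SHELL OF THE SQUARE TORUS BAND (cell gate-hubbard-kl, registrant seat gate-hubbard-kl-p1b g18; D-0071 pre-staging of
# route v3 step (ii), KL STATUS 2026-08-29 p1b g18)

WHAT.  For the band `ε_L(k) = -2(cos(2πk₀/L) + cos(2πk₁/L))` of `(ℤ/Lℤ)²` (`torusBand`), the shell `{|ε_L| ≤ η}` around the van Hove level `0` contains, for every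
`r` with `2r + 1 ≤ L`, at least `L·(2r+1)` momenta once `η ≥ 2π(2r+1)/L`:
**`card_vanHoveShell_ge : (L : ℝ)·(2r+1) ≤ #{k : |torusBand L k| ≤ 2π(2r+1)/L}`**.
The momenta are `k = (i, n − i)` with `i` arbitrary and `n ∈ [⌊L/2⌋ − r, ⌊L/2⌋ + r]`: then `k₀ + k₁ ≡ n (mod L)`, so by `cos a + cos b = 2cos((a+b)/2)cos((a−b)/2)`
and `|cos(πn/L)| = |sin(π/2 − πn/L)| ≤ π|L − 2n|/(2L) ≤ π(2r+1)/(2L)` the band value is at most `2π(2r+1)/L` in size — the two antidiagonals `k₀ + k₁ ≈ L/2`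
(and their wrap `≈ 3L/2`) of the nested Fermi square.  Choosing `r = ⌊(tL/(2π) − 1)/2⌋` gives `#{|ε_L| ≤ t} ≥ t·L²/(2π) − 2L`, the lower count that route v3 of
G-005 consumes (the tree's shell counts `card_torusShell_le_sqrt` / `card_torusShell_le` are UPPER bounds).
Elementary counting + trigonometry; nothing here asserts G-005, any row of 20437, K3, the Kohn–Luttinger margin or superconductivity.  0 kit · 0 lit.
References: folklore (lattice points near the nested square Fermi surface of the half-filled square lattice); BGM 2006 §2.2 (the band) [cite: BenfattoGiulianiMastropietro2006].
-/

noncomputable section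

namespace Summit.HubbardSuperconductivity.HubbardSuperconductivity.Theorems.MatsubaraTadpole

set_option linter.dupNamespace false -- summit = problem name (single-conjunct summit), D-0017

open Real Finset Literature.MathematicalPhysics.QuantumLattice Literature.Probability.LatticeModels

variable {L : ℕ} [NeZero L]

omit [NeZero L] in
/-- `|cos(πn/L)| ≤ π|L − 2n|/(2L)` (`cos x = sin(π/2 − x)`, `|sin y| ≤ |y|`). -/
theorem abs_cos_pi_mul_natCast_div_le (n : ℕ) (hL : (0 : ℝ) < L) :
    |Real.cos (π * n / L)| ≤ π * |(L : ℝ) - 2 * n| / (2 * L) := by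
  rw [← Real.sin_pi_div_two_sub]
  refine (Real.abs_sin_le_abs).trans (le_of_eq ?_)
  have h : π / 2 - π * (n : ℝ) / L = (π / (2 * L)) * ((L : ℝ) - 2 * n) := by
    field_simp
  rw [h, abs_mul, abs_of_pos (by positivity : (0 : ℝ) < π / (2 * L))]
  field_simp

/-- **The antidiagonal momenta lie in the van Hove shell**: if `k₀ + k₁ = n (mod L)` with `n < L`, then
`|ε_L(k)| ≤ 2π|L − 2n|/L`. -/
theorem abs_torusBand_le_of_sum_eq (k : TorusSite 2 L) {n : ℕ} (hn : n < L) (hk : k 0 + k 1 = (n : ZMod L)) :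
    |torusBand L k| ≤ 2 * π * |(L : ℝ) - 2 * n| / L := by
  have hL : (0 : ℝ) < L := by exact_mod_cast Nat.pos_of_ne_zero (NeZero.ne L)
  set A : ℕ := (k 0).val with hA
  set B : ℕ := (k 1).val with hB
  -- `A + B ≡ n (mod L)`
  have hmod : (A + B) % L = n := by
    have h := congrArg ZMod.val hk
    rw [ZMod.val_add, ZMod.val_cast_of_lt hn] at h
    exact h
  obtain ⟨q, hq⟩ : ∃ q : ℕ, A + B = n + L * q := ⟨(A + B) / L, by have := Nat.mod_add_div (A + B) L; omega⟩
  -- the sum-to-product formula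
  rw [torusBand_two_eq]
  have hsum : -2 * Real.cos (2 * π * (A : ℝ) / L) - 2 * Real.cos (2 * π * (B : ℝ) / L) =
      -4 * (Real.cos (π * (n : ℝ) / L + q * π) * Real.cos (π * ((A : ℝ) - B) / L)) := by
    have hab : (2 * π * (A : ℝ) / L + 2 * π * (B : ℝ) / L) / 2 = π * (n : ℝ) / L + q * π := by
      have hc : (A : ℝ) + B = n + L * q := by exact_mod_cast hq
      have h1 : (2 * π * (A : ℝ) / L + 2 * π * (B : ℝ) / L) / 2 = π * ((A : ℝ) + B) / L := by ring
      rw [h1, hc]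
      field_simp
    have hab' : (2 * π * (A : ℝ) / L - 2 * π * (B : ℝ) / L) / 2 = π * ((A : ℝ) - B) / L := by
      ring
    rw [show -2 * Real.cos (2 * π * (A : ℝ) / L) - 2 * Real.cos (2 * π * (B : ℝ) / L) =
      -2 * (Real.cos (2 * π * (A : ℝ) / L) + Real.cos (2 * π * (B : ℝ) / L)) by ring, Real.cos_add_cos, hab, hab']
    ring
  rw [hsum, Real.cos_add_nat_mul_pi]
  have h1 : |Real.cos (π * ((A : ℝ) - B) / L)| ≤ 1 := Real.abs_cos_le_one _
  have h2 := abs_cos_pi_mul_natCast_div_le n hL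
  have h3 : |((-1 : ℝ) ^ q)| = 1 := by rw [abs_pow, abs_neg, abs_one, one_pow]
  calc |-4 * ((-1) ^ q * Real.cos (π * (n : ℝ) / L) * Real.cos (π * ((A : ℝ) - B) / L))|
      = 4 * (|Real.cos (π * (n : ℝ) / L)| * |Real.cos (π * ((A : ℝ) - B) / L)|) := by
        rw [abs_mul, abs_mul, abs_mul, h3]; norm_num
    _ ≤ 4 * (π * |(L : ℝ) - 2 * n| / (2 * L) * 1) := by
        gcongr
    _ = 2 * π * |(L : ℝ) - 2 * n| / L := by field_simp; ring

/-- **Lower count of the van Hove shell**: for `2r + 1 ≤ L`, at least `L·(2r+1)` momenta `k ∈ (ℤ/Lℤ)²` have `|ε_L(k)| ≤ 2π(2r+1)/L`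
(the momenta `(i, n − i)`, `i ∈ ℤ/Lℤ`, `n ∈ [⌊L/2⌋ − r, ⌊L/2⌋ + r]`). -/
theorem card_vanHoveShell_ge (r : ℕ) (hr : 2 * r + 1 ≤ L) :
    (L : ℝ) * (2 * r + 1) ≤ ((univ.filter fun k : TorusSite 2 L => |torusBand L k| ≤ 2 * π * (2 * r + 1) / L).card : ℝ) := by
  classical
  have hL0 : 0 < L := Nat.pos_of_ne_zero (NeZero.ne L)
  have hLr : (0 : ℝ) < L := by exact_mod_cast hL0
  set c : ℕ := L / 2 with hc
  have hrc : r ≤ c := by omega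
  have hcr : c + r < L := by omega
  -- the parameter set and the injection
  set T : Finset ℕ := Finset.Icc (c - r) (c + r) with hT
  have hTcard : T.card = 2 * r + 1 := by rw [hT, Nat.card_Icc]; omega
  set φ : ZMod L × ℕ → TorusSite 2 L := fun p => ![p.1, (p.2 : ZMod L) - p.1] with hφ
  have hinj : Set.InjOn φ ↑((univ : Finset (ZMod L)) ×ˢ T) := by
    rintro ⟨i, n⟩ hin ⟨i', n'⟩ hin' h
    simp only [Finset.coe_product, Set.mem_prod, Finset.mem_coe, Finset.mem_univ, true_and, hT, Finset.mem_Icc] at hin hin'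
    have h0 := congrFun h 0
    have h1 := congrFun h 1
    simp only [hφ, Matrix.cons_val_zero, Matrix.cons_val_one] at h0 h1
    subst h0
    have hnn : ((n : ZMod L)) = (n' : ZMod L) := by
      have := congrArg (· + i) h1
      simpa using this
    have hv := congrArg ZMod.val hnn
    rw [ZMod.val_cast_of_lt (by omega), ZMod.val_cast_of_lt (by omega)] at hv
    subst hv
    rfl
  -- the image lies in the shell
  have himg : ((univ : Finset (ZMod L)) ×ˢ T).image φ ⊆
      univ.filter fun k : TorusSite 2 L => |torusBand L k| ≤ 2 * π * (2 * r + 1) / L := by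
    intro k hk
    rw [Finset.mem_image] at hk
    obtain ⟨⟨i, n⟩, hin, rfl⟩ := hk
    simp only [Finset.mem_product, Finset.mem_univ, true_and, hT, Finset.mem_Icc] at hin
    rw [Finset.mem_filter]
    refine ⟨Finset.mem_univ _, ?_⟩
    have hn : n < L := by omega
    have hsumk : φ (i, n) 0 + φ (i, n) 1 = (n : ZMod L) := by
      simp only [hφ, Matrix.cons_val_zero, Matrix.cons_val_one]; ring
    refine (abs_torusBand_le_of_sum_eq (φ (i, n)) hn hsumk).trans ?_
    have hbound : |(L : ℝ) - 2 * n| ≤ 2 * r + 1 := by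
      rw [abs_le]
      have h2c : 2 * c ≤ L ∧ L ≤ 2 * c + 1 := by omega
      constructor
      · have : (2 * n : ℝ) ≤ 2 * c + 2 * r := by exact_mod_cast (by omega : 2 * n ≤ 2 * c + 2 * r)
        have : (2 * c : ℝ) ≤ L := by exact_mod_cast h2c.1
        linarith
      · have : (2 * c : ℝ) - 2 * r ≤ 2 * n := by
          have : 2 * c ≤ 2 * n + 2 * r := by omega
          have : ((2 * c : ℕ) : ℝ) ≤ ((2 * n + 2 * r : ℕ) : ℝ) := by exact_mod_cast this
          push_cast at this; linarith
        have : (L : ℝ) ≤ 2 * c + 1 := by exact_mod_cast h2c.2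
        linarith
    have : 2 * π * |(L : ℝ) - 2 * n| / L ≤ 2 * π * (2 * r + 1) / L := by
      apply div_le_div_of_nonneg_right _ hLr.le
      exact mul_le_mul_of_nonneg_left hbound (by positivity)
    exact this
  -- count
  have hcard : (((univ : Finset (ZMod L)) ×ˢ T).image φ).card = L * (2 * r + 1) := by
    rw [Finset.card_image_of_injOn hinj, Finset.card_product, Finset.card_univ, ZMod.card, hTcard]
  calc (L : ℝ) * (2 * r + 1) = ((L * (2 * r + 1) : ℕ) : ℝ) := by push_cast; ring
    _ = ((((univ : Finset (ZMod L)) ×ˢ T).image φ).card : ℝ) := by rw [hcard]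
    _ ≤ _ := by exact_mod_cast Finset.card_le_card himg

/-- **The same count with a free threshold**: if `2π(2r+1)/L ≤ η` and `2r + 1 ≤ L` then `L·(2r+1) ≤ #{k : |ε_L(k)| ≤ η}`. -/
theorem card_vanHoveShell_ge_of_le {η : ℝ} (r : ℕ) (hr : 2 * r + 1 ≤ L) (hη : 2 * π * (2 * r + 1) / L ≤ η) :
    (L : ℝ) * (2 * r + 1) ≤ ((univ.filter fun k : TorusSite 2 L => |torusBand L k| ≤ η).card : ℝ) := by
  refine (card_vanHoveShell_ge r hr).trans ?_
  exact_mod_cast Finset.card_le_card (Finset.monotone_filter_right _ fun k _ (hk : |torusBand L k| ≤ _) => hk.trans hη)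

end Summit.HubbardSuperconductivity.HubbardSuperconductivity.Theorems.MatsubaraTadpole

end
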